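import Literature.Geometry.Lorentzian.LocalCausalityExp
import Literature.Geometry.Lorentzian.CauchyHypersurfaceCausalProofs
import HarnessLib

/-!
# Local closedness of the causal relation (O'Neill 1983, Ch. 14, Lemma 14.2)

In a normal neighbourhood the causal future of the centre is the image of the *closed* future
causal cone under the exponential map (O'Neill 1983, Ch. 14, Lemma 14.2 (2); Ch. 5, Lemma 5.33);
in particular the relation `≤` is closed there. For the tree's differentiable causal curves
(`LorentzianMetric.IsFutureCausalCurveOn`) we prove the following sequential form, on a
time-oriented Lorentzian manifold `(M, g, τ)` (Hausdorff, boundaryless model, smooth metric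
`∞ ≤ n`): **every point `q` has an open neighbourhood `W` such that**

* `LorentzianMetric.exists_nhds_mem_causalFuture_of_tendsto` — if `xₖ → q` and each `xₖ` is joined
  to `z ∈ W` by a future causal curve inside `W`, then `z ∈ J⁺(q)`;
* `LorentzianMetric.exists_nhds_mem_causalFuture_of_tendsto'` — if `zₖ → q` and each `zₖ` is
  reached from `x ∈ W` by a future causal curve inside `W`, then `q ∈ J⁺(x)`.

`W` is a uniformly normal neighbourhood of `q` (`exists_twoPoint_expInverse`); the proof is that of
`mem_causalFuture_of_hasPastEndpoint` (`CausalCurveEndpoint.lean`): read the curves in the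
exponential chart at the point `ρ σ` slightly to the past of `q` on the timelike geodesic with
velocity `-T_q`, where `exp_{ρ σ}⁻¹ q` is future timelike, hence `exp_{ρ σ}⁻¹ xₖ` is for large `k`,
so O'Neill's Lemma 5.33 (`radial_timecone_invariance`) keeps `exp_{ρ σ}⁻¹ z` future timelike; as
`σ → 0⁺`, `exp_q⁻¹ z` lies in the closed future causal cone of `T_qM` and the radial geodesic joins
`q` to `z` (`expMap_mem_causalFuture`). These are the local building blocks for closedness
statements about `J±` (limit-curve arguments, global hyperbolicity of Cauchy developments).

Everything is proved; no definitions and no named facts are introduced (D-0026).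

## References

* B. O'Neill, *Semi-Riemannian geometry with applications to relativity*, Academic Press 1983,
  Ch. 5, Lemma 5.33, Prop. 5.34 (pp. 146–147); Ch. 14, Lemma 14.2 (p. 402).
  [ONeillSemiRiemannian1983]
* J. M. Lee, *Introduction to Riemannian Manifolds*, 2nd ed. (2018), Prop. 5.19 (e).
  [LeeRiemannianManifolds2018]
-/

noncomputable section

open Bundle Set Filter Function
open scoped Manifold ContDiff Topology

namespace Literature.Geometry.Lorentzian

open Literature.Geometry.Riemannian

variable {E : Type*} [NormedAddCommGroup E] [NormedSpace ℝ E] {H : Type*} [TopologicalSpace H]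
  {I : ModelWithCorners ℝ E H} {M : Type*} [TopologicalSpace M] [ChartedSpace H M]
  [IsManifold I ∞ M] [FiniteDimensional ℝ E] [CompleteSpace E] [T2Space M] [I.Boundaryless]
  {n : ℕ∞ω} {g : LorentzianMetric I n M} [g.HasLeviCivita]
  [CovariantDerivative.ContMDiffCovariantDerivative g.leviCivita 1] (τ : TimeOrientation g)

namespace LorentzianMetric

/-- **Local closedness of `≤` in the first argument.** Every point `q` has an open neighbourhood
`W` (a uniformly normal neighbourhood, `exists_twoPoint_expInverse`) such that: if `xₖ → q` and
each `xₖ` is joined to the point `z ∈ W` by a future causal curve *inside `W`*, then `z ∈ J⁺(q)`.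
Proof as for `mem_causalFuture_of_hasPastEndpoint`: read the curves in the exponential chart at
the point `ρ σ` slightly to the past of `q` on the geodesic with velocity `-T_q`; `exp_{ρ σ}⁻¹ q`
is future timelike, hence so is `exp_{ρ σ}⁻¹ xₖ` for large `k`, and O'Neill's Lemma 5.33
(`radial_timecone_invariance`) gives `exp_{ρ σ}⁻¹ z` future timelike; as `σ → 0⁺`, `exp_q⁻¹ z`
lies in the closed future causal cone and the radial geodesic joins `q` to `z`. O'Neill 1983,
Ch. 5, Lemma 5.33; Ch. 14, Lemma 14.2 (the causal cone of a normal neighbourhood is the image of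
the closed causal cone). [cite: ONeillSemiRiemannian1983, Ch. 5, Lemma 5.33 (pp. 146–147); Ch. 14, Lemma 14.2 (p. 402)] -/
theorem exists_nhds_mem_causalFuture_of_tendsto (hn : (∞ : ℕ∞ω) ≤ n) (q : M) :
    ∃ W : Set M, IsOpen W ∧ q ∈ W ∧ ∀ z ∈ W, ∀ x : ℕ → M, Tendsto x atTop (𝓝 q) →
      (∀ k, ∃ (γ : ℝ → M) (a b : ℝ), a ≤ b ∧ g.IsFutureCausalCurveOn τ γ (Icc a b) ∧
        MapsTo γ (Icc a b) W ∧ γ a = x k ∧ γ b = z) →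
      z ∈ g.causalFuture τ {q} := by
  haveI : Fact (1 ≤ n) := ⟨le_trans (by exact_mod_cast le_top) hn⟩
  haveI := contMDiffCovariantDerivative_leviCivita_infty g.toPseudoRiemannianMetric hn
  set cov := g.leviCivita with hcov
  obtain ⟨W, Src, Ξ, hWo, hoW, hWsrc, hSo, hS0, hSdom, hinjF, hΞ, hΞs, hΦs⟩ :=
    exists_twoPoint_expInverse (cov := cov) q
  set e := trivializationAt E (TangentSpace I : M → Type _) q with he
  have hbase : e.baseSet = (chartAt H q).source := TangentBundle.trivializationAt_baseSet q
  have hoe : q ∈ e.baseSet := by rw [hbase]; exact hWsrc hoW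
  refine ⟨W, hWo, hoW, fun z hzW x hx hcurves ↦ ?_⟩
  /- (A) the chart curve at a base point `p ∈ W` of a causal segment `γ|[a', b'] ⊆ W` -/
  have hA : ∀ (γ : ℝ → M) (a' b' : ℝ), g.IsFutureCausalCurveOn τ γ (Icc a' b') →
      MapsTo γ (Icc a' b') W → ∀ p ∈ W,
      ∃ β β' : ℝ → E, (∀ t, β t = e.symmL ℝ p (Ξ p (γ t))) ∧
      (∀ t ∈ Icc a' b', HasDerivAt β (β' t) t) ∧
      (∀ t ∈ Icc a' b', (β t : TangentSpace I p) ∈ expDomain cov p) ∧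
      (∀ t ∈ Icc a' b', τ.IsFutureDirected (velocity I (fun s ↦ expMap cov p (β s)) t)) := by
    intro γ a' b' hγ' hγW p hp
    have hγc : ∀ t ∈ Icc a' b', ContinuousAt γ t := fun t ht ↦ (hγ' t ht).1.continuousAt
    have hγnear : ∀ t ∈ Icc a' b', ∀ᶠ s in 𝓝 t, γ s ∈ W := fun t ht ↦
      (hγc t ht).preimage_mem_nhds (hWo.mem_nhds (hγW ht))
    set L : E →L[ℝ] E := e.symmL ℝ p with hL
    set K : M → E := fun w ↦ Ξ p w with hK
    have hKs : ContMDiffOn I 𝓘(ℝ, E) ∞ K W := by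
      have h1 : ContMDiff I (I.prod I) ∞ (fun w : M ↦ (p, w)) := contMDiff_const.prodMk contMDiff_id
      exact hΞs.comp h1.contMDiffOn fun w hw ↦ ⟨hp, hw⟩
    set β : ℝ → E := fun t ↦ L (K (γ t)) with hβ
    have hdiff : ∀ t ∈ Icc a' b', DifferentiableAt ℝ (fun s ↦ K (γ s)) t := by
      intro t ht
      have hKd : MDifferentiableAt I 𝓘(ℝ, E) K (γ t) :=
        (hKs.contMDiffAt (hWo.mem_nhds (hγW ht))).mdifferentiableAt (by simp)
      have h := hKd.comp t (hγ' t ht).1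
      exact mdifferentiableAt_iff_differentiableAt.1 h
    set β' : ℝ → E := fun t ↦ L (deriv (fun s ↦ K (γ s)) t) with hβ'
    refine ⟨β, β', fun t ↦ rfl, fun t ht ↦ L.hasFDerivAt.comp_hasDerivAt t (hdiff t ht).hasDerivAt,
      fun t ht ↦ (hSdom _ (hΞ p hp (γ t) (hγW ht)).1).2, fun t ht ↦ ?_⟩
    have hev : (fun s ↦ expMap cov p (β s)) =ᶠ[𝓝 t] γ := by
      filter_upwards [hγnear t ht] with s hs
      exact (hΞ p hp (γ s) hs).2
    have hvel : velocity I (fun s ↦ expMap cov p (β s)) t = velocity I γ t :=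
      velocity_congr_of_eventuallyEq (I := I) hev
    have hpt : expMap cov p (β t) = γ t := hev.eq_of_nhds
    rw [hvel, hpt]
    exact (hγ' t ht).2
  /- (B) the past timelike geodesic `ρ` from `q` with velocity `-T_q` -/
  set u : TangentSpace I q := -τ.vectorField q with hu
  obtain ⟨hρmax, hρ0, hρo, hρv⟩ := maximalGeodesic_spec' (cov := cov) q u
  set ρ := maximalGeodesic cov q u with hρ
  set Dρ := maximalGeodesicDomain cov q u with hDρ
  have hDo : IsOpen Dρ := hρmax.isOpen
  have hρgeo : IsGeodesicOn cov ρ Dρ := hρmax.isGeodesicOn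
  have hupast : τ.reverse.IsFutureDirected u := by
    rw [TimeOrientation.isFutureDirected_reverse_iff]
    have hT := τ.isTimelike q
    refine ⟨(g.isCausal_neg_iff _).2 hT.isCausal, ?_⟩
    show 0 < g.val q (τ.vectorField q) (-τ.vectorField q)
    rw [map_neg]
    exact neg_pos.2 hT
  have hut : g.IsTimelike u := (g.isTimelike_neg_iff _).2 (τ.isTimelike q)
  have hρ' : ∀ s ∈ Dρ, g.IsTimelike (velocity I ρ s) ∧ τ.IsPastDirected (velocity I ρ s) := by
    intro s hs
    have h := hρgeo.isTimelike_and_isFutureDirected_velocity τ.reverse hDo hρmax.2.1 hρ0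
      (by rw [hρv, hρo]; exact hut) (by rw [hρv, hρo]; exact hupast) hs
    exact ⟨h.1, (TimeOrientation.isFutureDirected_reverse_iff _ _).1 h.2⟩
  have hw : ∀ s ∈ Dρ, 0 < s → g.IsTimelike ((-s) • velocity I ρ s) ∧
      τ.IsFutureDirected ((-s) • velocity I ρ s) := by
    intro s hs hs0
    have hneg : τ.IsFutureDirected (-velocity I ρ s) :=
      (TimeOrientation.isFutureDirected_neg_iff _ _).2 (hρ' s hs).2
    have h1 : (-s) • velocity I ρ s = s • (-velocity I ρ s) := by rw [neg_smul, smul_neg]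
    rw [h1]
    exact ⟨((g.isTimelike_neg_iff _).2 (hρ' s hs).1).smul hs0.ne', hneg.smul hs0⟩
  have hexpw : ∀ s ∈ Dρ, ((-s) • velocity I ρ s) ∈ expDomain cov (ρ s) ∧
      expMap cov (ρ s) ((-s) • velocity I ρ s) = q := by
    intro s hs
    set κ : ℝ → M := fun r ↦ ρ ((-1) * r + s) with hκ
    set s' : Set ℝ := (fun r ↦ (-1) * r + s) ⁻¹' Dρ with hs'
    have hκgeo : IsGeodesicOn cov κ s' := IsGeodesicOn.comp_affine_holds hρgeo (-1) s
    have hs'o : IsOpen s' := hDo.preimage ((continuous_const.mul continuous_id).add continuous_const)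
    have hs'c : s'.OrdConnected := by
      refine ⟨fun x₁ hx y hy r hr ↦ ?_⟩
      show (-1) * r + s ∈ Dρ
      have hx' : (-1) * x₁ + s ∈ Dρ := hx
      have hy' : (-1) * y + s ∈ Dρ := hy
      exact hρmax.2.1.out hy' hx' ⟨by linarith [hr.2], by linarith [hr.1]⟩
    have h0' : (0 : ℝ) ∈ s' := by show (-1) * 0 + s ∈ Dρ; simpa using hs
    have hκ0 : κ 0 = ρ s := by show ρ ((-1) * 0 + s) = ρ s; simp
    have hκv : velocity I κ 0 = (-1 : ℝ) • velocity I ρ s := by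
      have h := velocity_comp_affine (I := I) ρ (-1) s 0
      rw [show (-1 : ℝ) * 0 + s = s by ring] at h
      exact h
    obtain ⟨hsub, heq⟩ := subset_maximalGeodesicDomain_of_isGeodesicOn hs'o hs'c h0' hκgeo hκ0 hκv
    have hss' : s ∈ s' := by show (-1) * s + s ∈ Dρ; simpa using hρ0
    have hsD : s ∈ maximalGeodesicDomain cov (ρ s) ((-1 : ℝ) • velocity I ρ s) := hsub hss'
    have h := expMap_smul_of_mem (cov := cov) (ρ s) ((-1 : ℝ) • velocity I ρ s) hsD
    rw [smul_smul, mul_neg, mul_one] at h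
    refine ⟨h.1, ?_⟩
    rw [h.2, ← heq hss']
    show ρ ((-1) * s + s) = q
    have : (-1) * s + s = 0 := by ring
    rw [this, hρo]
  set G : ℝ → M × E := fun s ↦ (ρ s, (-s) • (e (tangentLift I ρ s)).2) with hG
  have hGc : ContinuousAt G 0 := by
    have h1 : ContinuousAt (tangentLift I ρ) 0 :=
      (continuousOn_tangentLift_maximalGeodesic (cov := cov) q u).continuousAt (hDo.mem_nhds hρ0)
    have h2 : ContinuousAt e (tangentLift I ρ 0) := by
      refine e.toOpenPartialHomeomorph.continuousAt (e.mem_source.2 ?_)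
      show ρ 0 ∈ e.baseSet
      rw [hρo]; exact hoe
    have h3 : ContinuousAt (fun s ↦ (e (tangentLift I ρ s)).2) 0 :=
      continuousAt_snd.comp (h2.comp h1)
    have h4 : ContinuousAt ρ 0 := (IsGeodesicOn.mdifferentiableAt_holds hρgeo hρ0).continuousAt
    exact h4.prodMk ((continuous_neg.continuousAt).smul h3)
  have hG0 : G 0 = (q, 0) := by
    show (ρ 0, (-(0 : ℝ)) • (e (tangentLift I ρ 0)).2) = (q, 0)
    rw [neg_zero, zero_smul, hρo]
  have hgood : ∀ᶠ s in 𝓝[>] (0 : ℝ), (s ∈ Dρ ∧ ρ s ∈ W ∧ G s ∈ Src) ∧ 0 < s := by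
    have h1 : ∀ᶠ s in 𝓝 (0 : ℝ), s ∈ Dρ := hDo.mem_nhds hρ0
    have h2 : ∀ᶠ s in 𝓝 (0 : ℝ), ρ s ∈ W := by
      have hc : ContinuousAt ρ 0 := hGc.fst
      exact hc.preimage_mem_nhds (hWo.mem_nhds (by show ρ 0 ∈ W; rw [hρo]; exact hoW))
    have h3 : ∀ᶠ s in 𝓝 (0 : ℝ), G s ∈ Src :=
      hGc.preimage_mem_nhds (hSo.mem_nhds (by rw [hG0]; exact hS0 q hoW))
    have h123 := ((h1.and h2).and h3).filter_mono (nhdsWithin_le_nhds (s := Ioi (0 : ℝ)))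
    have h4 : ∀ᶠ s in 𝓝[>] (0 : ℝ), 0 < s := eventually_mem_nhdsWithin
    filter_upwards [h123, h4] with s hs hs'
    exact ⟨⟨hs.1.1, hs.1.2, hs.2⟩, hs'⟩
  /- (C) at a good `σ`, `exp_{ρ σ}⁻¹ z` is future timelike -/
  have hstep : ∀ σ, (σ ∈ Dρ ∧ ρ σ ∈ W ∧ G σ ∈ Src) → 0 < σ →
      g.IsTimelike (x := ρ σ) (e.symmL ℝ (ρ σ) (Ξ (ρ σ) z)) ∧
      τ.IsFutureDirected (x := ρ σ) (e.symmL ℝ (ρ σ) (Ξ (ρ σ) z)) := by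
    rintro σ ⟨hσD, hσW, hσSrc⟩ hσ0
    have hσe : ρ σ ∈ e.baseSet := by rw [hbase]; exact hWsrc hσW
    set ξs : E := (-σ) • (e (tangentLift I ρ σ)).2 with hξs
    have hξs' : ξs = (e ⟨ρ σ, (-σ) • velocity I ρ σ⟩).2 := by
      rw [hξs, trivializationAt_snd_smul (I := I) (hWsrc hσW)]
      rfl
    have hsymm : e.symmL ℝ (ρ σ) ξs = (-σ) • velocity I ρ σ := by
      rw [hξs', e.symmL_apply hσe, e.symm_apply_apply_mk hσe]
    have hΞσ : Ξ (ρ σ) q = ξs := by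
      have h1 : (ρ σ, Ξ (ρ σ) q) ∈ Src := (hΞ (ρ σ) hσW q hoW).1
      have heq : (fun w : M × E ↦ (w.1, expMap cov w.1 (e.symmL ℝ w.1 w.2))) (ρ σ, Ξ (ρ σ) q) =
          (fun w : M × E ↦ (w.1, expMap cov w.1 (e.symmL ℝ w.1 w.2))) (ρ σ, ξs) := by
        show (ρ σ, expMap cov (ρ σ) (e.symmL ℝ (ρ σ) (Ξ (ρ σ) q))) =
          (ρ σ, expMap cov (ρ σ) (e.symmL ℝ (ρ σ) ξs))
        rw [(hΞ (ρ σ) hσW q hoW).2, hsymm, (hexpw σ hσD).2]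
      exact (Prod.ext_iff.1 (hinjF h1 hσSrc heq)).2
    have hstart : g.IsTimelike (x := ρ σ) (e.symmL ℝ (ρ σ) (Ξ (ρ σ) q)) ∧
        τ.IsFutureDirected (x := ρ σ) (e.symmL ℝ (ρ σ) (Ξ (ρ σ) q)) := by
      rw [hΞσ, hsymm]; exact hw σ hσD hσ0
    set C : Set E := {v : E | g.IsTimelike (x := ρ σ) v ∧ τ.IsFutureDirected (x := ρ σ) v} with hC
    have hCo : IsOpen C := τ.isOpen_setOf_isTimelike_and_isFutureDirected (ρ σ)
    have hKc : ContinuousAt (fun w : M ↦ e.symmL ℝ (ρ σ) (Ξ (ρ σ) w)) q := by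
      have h1 : ContMDiff I (I.prod I) ∞ (fun w : M ↦ (ρ σ, w)) := contMDiff_const.prodMk contMDiff_id
      have h2 : ContMDiffOn I 𝓘(ℝ, E) ∞ (fun w : M ↦ Ξ (ρ σ) w) W :=
        hΞs.comp h1.contMDiffOn fun w hw ↦ ⟨hσW, hw⟩
      have h3 : ContinuousAt (fun w : M ↦ Ξ (ρ σ) w) q :=
        (h2.continuousOn.continuousAt (hWo.mem_nhds hoW))
      exact (e.symmL ℝ (ρ σ)).continuous.continuousAt.comp h3
    have hN : (fun w : M ↦ e.symmL ℝ (ρ σ) (Ξ (ρ σ) w)) ⁻¹' C ∈ 𝓝 q :=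
      hKc.preimage_mem_nhds (hCo.mem_nhds hstart)
    -- a member of the sequence in that neighbourhood, and its curve to `z`
    obtain ⟨k, hk⟩ := (hx.eventually (eventually_mem_set.2 hN)).exists
    obtain ⟨γ, a', b', hab', hγ', hγW, hγa, hγb⟩ := hcurves k
    obtain ⟨βs, βs', hβsdef, hβsd, hβsdom, hβsfut⟩ := hA γ a' b' hγ' hγW (ρ σ) hσW
    have hβsa : g.IsTimelike (x := ρ σ) (βs a') ∧ τ.IsFutureDirected (x := ρ σ) (βs a') := by
      rw [hβsdef a', hγa]; exact hk
    obtain ⟨hall, -⟩ := radial_timecone_invariance τ hn hβsd hβsdom hβsfut hβsa.1 hβsa.2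
    have h := hall b' ⟨hab', le_rfl⟩
    rw [hβsdef b', hγb] at h
    exact h
  /- (D) pass to the limit `σ → 0⁺` in `TM` -/
  have hcone : g.val q (e.symmL ℝ q (Ξ q z)) (e.symmL ℝ q (Ξ q z)) ≤ 0 ∧
      g.val q (τ.vectorField q) (e.symmL ℝ q (Ξ q z)) ≤ 0 := by
    set Φ : M × M → TangentBundle I M := fun qz ↦
      TotalSpace.mk' E qz.1 (e.symmL ℝ qz.1 (Ξ qz.1 qz.2)) with hΦ
    have hΦc : ContinuousAt Φ (q, z) :=
      hΦs.continuousOn.continuousAt ((hWo.prod hWo).mem_nhds ⟨hoW, hzW⟩)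
    have hpath : Tendsto (fun s ↦ (ρ s, z)) (𝓝[>] (0 : ℝ)) (𝓝 (q, z)) := by
      have hc : ContinuousAt ρ 0 := hGc.fst
      have h1 : Tendsto ρ (𝓝 (0 : ℝ)) (𝓝 q) := by rw [← hρo]; exact hc
      exact ((h1.mono_left nhdsWithin_le_nhds).prodMk_nhds tendsto_const_nhds)
    have hlim : Tendsto (fun s ↦ Φ (ρ s, z)) (𝓝[>] (0 : ℝ)) (𝓝 (Φ (q, z))) :=
      hΦc.tendsto.comp hpath
    obtain ⟨hQ₁, hQ₂⟩ := LorentzianMetric.continuous_val_snd_snd g τ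
    have hlim₁ := (hQ₁.tendsto _).comp hlim
    have hlim₂ := (hQ₂.tendsto _).comp hlim
    have hev₁ : ∀ᶠ s in 𝓝[>] (0 : ℝ),
        (fun v : TangentBundle I M ↦ g.val v.proj v.2 v.2) (Φ (ρ s, z)) ≤ 0 := by
      filter_upwards [hgood] with s hs
      exact le_of_lt (hstep s hs.1 hs.2).1
    have hev₂ : ∀ᶠ s in 𝓝[>] (0 : ℝ),
        (fun v : TangentBundle I M ↦ g.val v.proj (τ.vectorField v.proj) v.2) (Φ (ρ s, z)) ≤ 0 := by
      filter_upwards [hgood] with s hs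
      exact le_of_lt (hstep s hs.1 hs.2).2.2
    exact ⟨le_of_tendsto hlim₁ hev₁, le_of_tendsto hlim₂ hev₂⟩
  /- (E) conclusion -/
  set v : TangentSpace I q := e.symmL ℝ q (Ξ q z) with hv
  have hvdom : v ∈ expDomain cov q := (hSdom _ (hΞ q hoW z hzW).1).2
  have hexpv : expMap cov q v = z := (hΞ q hoW z hzW).2
  by_cases hv0 : v = 0
  · have : z = q := by rw [← hexpv, hv0]; exact expMap_zero (cov := cov) q
    rw [this]; exact subset_causalFuture g τ _ (mem_singleton _)
  · have hT : g.IsTimelike (τ.vectorField q) := τ.isTimelike q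
    have hvc : g.IsCausal v := ⟨hcone.1, hv0⟩
    have hvf : τ.IsFutureDirected v :=
      ⟨hvc, lt_of_le_of_ne hcone.2 (g.val_ne_zero_of_isTimelike_of_isCausal hT hvc)⟩
    rw [← hexpv]
    exact expMap_mem_causalFuture τ hvdom hvf

/-- **Local closedness of `≤` in the second argument** (time dual): every `q` has an open
neighbourhood `W` such that if `zₖ → q` and each `zₖ` is reached from the point `x ∈ W` by a
future causal curve inside `W`, then `q ∈ J⁺(x)`.
[cite: ONeillSemiRiemannian1983, Ch. 5, Lemma 5.33 (pp. 146–147); Ch. 14, Lemma 14.2 (p. 402)] -/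
theorem exists_nhds_mem_causalFuture_of_tendsto' (hn : (∞ : ℕ∞ω) ≤ n) (q : M) :
    ∃ W : Set M, IsOpen W ∧ q ∈ W ∧ ∀ x ∈ W, ∀ z : ℕ → M, Tendsto z atTop (𝓝 q) →
      (∀ k, ∃ (γ : ℝ → M) (a b : ℝ), a ≤ b ∧ g.IsFutureCausalCurveOn τ γ (Icc a b) ∧
        MapsTo γ (Icc a b) W ∧ γ a = x ∧ γ b = z k) →
      q ∈ g.causalFuture τ {x} := by
  obtain ⟨W, hWo, hqW, hW⟩ := exists_nhds_mem_causalFuture_of_tendsto τ.reverse hn q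
  refine ⟨W, hWo, hqW, fun x hxW z hz hcurves ↦ ?_⟩
  have h : x ∈ g.causalFuture τ.reverse {q} := by
    refine hW x hxW z hz fun k ↦ ?_
    obtain ⟨γ, a, b, hab, hγ, hγW, hγa, hγb⟩ := hcurves k
    refine ⟨γ ∘ Neg.neg, -b, -a, neg_le_neg hab, ?_, fun t ht ↦ hγW ?_, ?_, ?_⟩
    · have h := hγ.comp_neg
      have hs : Neg.neg ⁻¹' Icc a b = Icc (-b) (-a) := by
        ext t; simp only [mem_preimage, mem_Icc]; constructor <;> intro h' <;> constructor <;>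
          linarith [h'.1, h'.2]
      rw [hs] at h
      exact h
    · exact ⟨by linarith [ht.2], by linarith [ht.1]⟩
    · show γ (-(-b)) = z k
      rw [neg_neg]; exact hγb
    · show γ (-(-a)) = x
      rw [neg_neg]; exact hγa
  exact mem_causalPast_singleton_iff.1 h

end LorentzianMetric

end Literature.Geometry.Lorentzian

end
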